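import Summits.ResolutionOfSingularities.ResolutionOfSingularities.Theorems.DescentDescentPerfectToAllRungBZero

/-!
# Route `Descent`, item `HironakaBridgeEmbeddedToPerfect` (stmt-ResolutionOfSingularities-19707): PROVED

OURS rung B, step B0 (plan/RUNG-B.md v0.2; cell res-hironaka; not a statement of any manuscript, no
candidate asserted): for each prime `p`, IF every integral closed subscheme of a smooth irreducible
separated quasi-compact scheme over a PERFECT field of characteristic `p` has a resolution, THEN every
reduced separated scheme of finite type over every perfect field of characteristic `p` has one. The
statement is verbatim the item's signature; the proof is `Theorems.rungB0`
(`DescentDescentPerfectToAllRungBZero.lean`: Chow's lemma — an integral `X` is dominated properly and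
birationally by a closed subscheme of a non-empty open of `𝐏ⁿ_K`, a smooth irreducible separated
quasi-compact ambient), which does not even use `p.Prime`, `CharP` or `PerfectField`.
-/

noncomputable section

set_option linter.dupNamespace false -- mandated namespace of this single-conjunct summit

namespace Summit.ResolutionOfSingularities.ResolutionOfSingularities.Theorems

/-- **Item `HironakaBridgeEmbeddedToPerfect` (stmt-ResolutionOfSingularities-19707), proved**: embedded
resolution in smooth irreducible ambients over perfect fields of characteristic `p` implies resolution
of all reduced separated schemes of finite type over perfect fields of characteristic `p` (Chow's
lemma; `Theorems.rungB0`). [cite: Kollar2007, Thm. 3.36 from Cor. 3.22 (pp. 124, 132)] -/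
theorem hironakaBridgeEmbeddedToPerfect_proof : ∀ p : ℕ, p.Prime → (∀ (K : Type) [Field K] [CharP K p] [PerfectField K] (Z X : AlgebraicGeometry.Scheme.{0}) (g : Z ⟶ AlgebraicGeometry.Spec (.of K)) (i : X ⟶ Z), AlgebraicGeometry.IsSeparated g → AlgebraicGeometry.LocallyOfFiniteType g → AlgebraicGeometry.QuasiCompact g → AlgebraicGeometry.Smooth g → IrreducibleSpace Z → AlgebraicGeometry.IsClosedImmersion i → AlgebraicGeometry.IsIntegral X → Literature.AlgebraicGeometry.Resolution.Scheme.HasResolution X) → (∀ (k : Type) [Field k] [CharP k p] [PerfectField k] (X : AlgebraicGeometry.Scheme.{0}) (f : X ⟶ AlgebraicGeometry.Spec (.of k)), AlgebraicGeometry.IsSeparated f → AlgebraicGeometry.LocallyOfFiniteType f → AlgebraicGeometry.QuasiCompact f → AlgebraicGeometry.IsReduced X → Literature.AlgebraicGeometry.Resolution.Scheme.HasResolution X) :=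
  fun p _ => rungB0 p

end Summit.ResolutionOfSingularities.ResolutionOfSingularities.Theorems

end
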